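import Mathlib
import Summits.RiemannHypothesis.RiemannHypothesis.Theorems.SignConeConeMagnificationDesignDeficitStep

/-!
# Crux `SignCone.ConeMagnification` (stmt-RiemannHypothesis-16303), line `Sketch` r8, stub `stub_designOfTypes`:
# Step 3 — the prime deficit at `σ = 1/2` and AX-A

Seat-0 programme for the open core `stub_designOfTypes` (design algebra §3–4).  Taking `Q` = all primes `≤ z` in
Step 2 (`deficit_finset_le_level`), the pollution `X_p(Q)` is a tail `Σ_{n > z, p ∣ n} c(n)/n` of a convergent
series (Loc), so `z → ∞` gives, for EVERY finite set `D` of primes,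

* `deficit_finset_le`:  `Σ_{p∈D} (log p − c(p))/√p ≤ 12 − 24 C₁`;
* `summable_deficit_sqrt`: `Σ_p (log p − c(p))₊/√p < ∞` — the prime deficit at the scale `1/2` (the output of the
  whole 2001 spine, obtained here directly);
* `summable_abs_dwt_div` (AX-A): `Σ_n |c(n) − Λ(n)|/n < ∞` (the negative part of `c − Λ` lives on prime powers and is
  summable by the above; the partial sums of `(c − Λ)/n` converge, so the positive part is summable too).
-/

noncomputable section

-- `Summit.RiemannHypothesis.RiemannHypothesis.…` repeats a namespace component by design (D-0017 layout).
set_option linter.dupNamespace false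

open Finset Filter
open scoped BigOperators ComplexConjugate Topology

namespace Summit.RiemannHypothesis.RiemannHypothesis.Theorems.SignConeConeMagnification

namespace Design

open Summit.RiemannHypothesis.RiemannHypothesis.Cruxes.ConeMagnification.Sketch
  (summable_vonMangoldt_nonprime_rpow)

/-! ### The pollution at level `z` is a tail -/

/-- An index of the pollution series `X_p(primes ≤ z)` exceeds `z`. [folklore] -/
theorem lt_of_pollution_index {p z n : ℕ} (hp : p.Prime)
    (h : p ∣ n ∧ ¬ p ^ 2 ∣ n ∧ n ≠ p ∧ (∀ q ∈ Nat.primesLE z, q ∣ n → q = p)) : z < n := by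
  obtain ⟨hpn, hp2, hnp, hall⟩ := h
  by_contra hzn
  push Not at hzn
  obtain ⟨m, rfl⟩ := hpn
  have hm1 : m ≠ 1 := fun h => hnp (by rw [h, mul_one])
  have hm0 : m ≠ 0 := fun h => by
    subst h
    exact hp2 ⟨0, by ring⟩
  -- a prime factor of `m` is a prime `≤ z` dividing `n`, hence equals `p`: then `p² ∣ n`
  obtain ⟨q, hq, hqm⟩ := Nat.exists_prime_and_dvd hm1
  have hqn : q ∣ p * m := dvd_mul_of_dvd_right hqm p
  have hqz : q ≤ z := le_trans (Nat.le_of_dvd (Nat.pos_of_ne_zero (mul_ne_zero hp.ne_zero hm0)) hqn) hzn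
  have hqp : q = p := hall q (Nat.mem_primesLE.2 ⟨hqz, hq⟩) hqn
  subst hqp
  exact hp2 (by rw [pow_two]; exact mul_dvd_mul_left q hqm)

/-- The pollution at level `z` is bounded by the tail `Σ'_{k} c(k + (z+1)) 𝟙_{p ∣ ·}/(·)` of the local series. [folklore] -/
theorem pollution_le_tail (c : ℕ → ℝ) (hc0 : ∀ n, 0 ≤ c n)
    (hLoc : ∀ p : ℕ, p.Prime → Summable (fun n : ℕ => if p ∣ n then c n / n else 0)) (p : ℕ) (hp : p.Prime)
    (z : ℕ) :
    ∑' n : ℕ, (if p ∣ n ∧ ¬ p ^ 2 ∣ n ∧ n ≠ p ∧ (∀ q ∈ Nat.primesLE z, q ∣ n → q = p) then c n / n else 0) ≤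
      ∑' k : ℕ, (fun n : ℕ => if p ∣ n then c n / n else (0 : ℝ)) (k + (z + 1)) := by
  classical
  set f : ℕ → ℝ := fun n => if p ∣ n then c n / n else 0 with hf
  clear_value f
  have hf0 : ∀ n, 0 ≤ f n := fun n => by
    rw [hf]; dsimp only; split_ifs
    · exact div_nonneg (hc0 n) (Nat.cast_nonneg _)
    · exact le_rfl
  have hfs : Summable f := by rw [hf]; exact hLoc p hp
  -- the tail as a series over `ℕ` with the indicator `z < n`
  have htail : ∑' k : ℕ, f (k + (z + 1)) = ∑' n : ℕ, (if z < n then f n else 0) := by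
    have h1 := hfs.sum_add_tsum_nat_add (z + 1)
    have h2 : ∑' n : ℕ, (if z < n then f n else 0) = ∑' n : ℕ, f n - ∑ i ∈ Finset.range (z + 1), f i := by
      have h3 : ∑ i ∈ Finset.range (z + 1), f i = ∑' n : ℕ, (if n ≤ z then f n else 0) := by
        rw [tsum_eq_sum (s := Finset.range (z + 1)) (fun n hn => if_neg (fun h => hn
          (Finset.mem_range.2 (by omega))))]
        exact Finset.sum_congr rfl fun n hn => (if_pos (by have := Finset.mem_range.1 hn; omega)).symm
      have h4 : Summable (fun n : ℕ => if n ≤ z then f n else 0) :=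
        summable_of_ne_finset_zero (s := Finset.range (z + 1)) (fun n hn => if_neg (fun h => hn
          (Finset.mem_range.2 (by omega))))
      have h5 : Summable (fun n : ℕ => if z < n then f n else 0) := by
        refine Summable.of_nonneg_of_le (fun n => ?_) (fun n => ?_) hfs
        · by_cases h : z < n
          · rw [if_pos h]; exact hf0 n
          · rw [if_neg h]
        · by_cases h : z < n
          · rw [if_pos h]
          · rw [if_neg h]; exact hf0 n
      have h6 : ∑' n : ℕ, f n = ∑' n : ℕ, (if z < n then f n else 0) + ∑' n : ℕ, (if n ≤ z then f n else 0) := by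
        rw [← h5.tsum_add h4]
        congr 1
        funext n
        by_cases h : z < n
        · rw [if_pos h, if_neg (by omega), add_zero]
        · rw [if_neg h, if_pos (by omega), zero_add]
      rw [h3]
      linarith
    rw [h2, ← h1, add_sub_cancel_left]
  rw [htail]
  have hfn : ∀ n, f n = if p ∣ n then c n / n else 0 := fun n => by rw [hf]
  refine Summable.tsum_le_tsum (fun n => ?_) ?_ ?_
  · by_cases h : p ∣ n ∧ ¬ p ^ 2 ∣ n ∧ n ≠ p ∧ (∀ q ∈ Nat.primesLE z, q ∣ n → q = p)
    · rw [if_pos h, if_pos (lt_of_pollution_index hp h), hfn n, if_pos h.1]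
    · rw [if_neg h]
      by_cases h' : z < n
      · rw [if_pos h']; exact hf0 n
      · rw [if_neg h']
  · refine Summable.of_nonneg_of_le (fun n => ?_) (fun n => ?_) hfs
    · by_cases h : p ∣ n ∧ ¬ p ^ 2 ∣ n ∧ n ≠ p ∧ (∀ q ∈ Nat.primesLE z, q ∣ n → q = p)
      · rw [if_pos h]; exact div_nonneg (hc0 n) (Nat.cast_nonneg _)
      · rw [if_neg h]
    · by_cases h : p ∣ n ∧ ¬ p ^ 2 ∣ n ∧ n ≠ p ∧ (∀ q ∈ Nat.primesLE z, q ∣ n → q = p)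
      · rw [if_pos h, hfn n, if_pos h.1]
      · rw [if_neg h]; exact hf0 n
  · refine Summable.of_nonneg_of_le (fun n => ?_) (fun n => ?_) hfs
    · by_cases h : z < n
      · rw [if_pos h]; exact hf0 n
      · rw [if_neg h]
    · by_cases h : z < n
      · rw [if_pos h]
      · rw [if_neg h]; exact hf0 n

/-! ### Step 3: the deficit over every finite set of primes -/

/-- **The prime deficit at the scale `1/2` is bounded on every finite set of primes** (seat-0, design algebra §3):
under Loc and TI, `Σ_{p∈D} (log p − c(p))/√p ≤ 12 − 24 C₁` for every finite set `D` of primes. [folklore] -/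
theorem deficit_finset_le (c : ℕ → ℝ) (hc0 : ∀ n, 0 ≤ c n)
    (hLoc : ∀ p : ℕ, p.Prime → Summable (fun n : ℕ => if p ∣ n then c n / n else 0))
    (hTI : ∀ α : ℕ → ℂ, ∀ L : ℕ, (∀ m, L < m → α m = 0) →
      ∃ T : ℝ, Tendsto (fun x : ℝ => ∑ n ∈ Finset.Icc 1 ⌊x⌋₊,
          (c n - ArithmeticFunction.vonMangoldt n) / n *
            (∑ ℓ ∈ Finset.Icc 1 L, ∑ ℓ' ∈ Finset.Icc 1 L, α ℓ * (starRingEnd ℂ) (α ℓ') *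
            (((Nat.gcd (n * ℓ') ℓ : ℕ) : ℝ) : ℂ) / (Real.sqrt ((ℓ : ℝ) * ℓ') : ℂ)).re) atTop (𝓝 T) ∧
        T ≤ 1 / 2 * (∑ ℓ ∈ Finset.Icc 1 L, ∑ ℓ' ∈ Finset.Icc 1 L, α ℓ * (starRingEnd ℂ) (α ℓ') *
            (((Nat.gcd (1 * ℓ') ℓ : ℕ) : ℝ) : ℂ) / (Real.sqrt ((ℓ : ℝ) * ℓ') : ℂ)).re)
    (C₁ : ℝ) (hC₁ : Tendsto (fun x : ℝ => ∑ n ∈ Finset.Icc 1 ⌊x⌋₊,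
        (c n - ArithmeticFunction.vonMangoldt n) / n) atTop (𝓝 C₁)) (hC₁le : C₁ ≤ 1 / 2)
    (D : Finset ℕ) (hD : ∀ p ∈ D, p.Prime) :
    ∑ p ∈ D, (Real.log p - c p) / Real.sqrt p ≤ 12 - 24 * C₁ := by
  classical
  refine le_of_forall_pos_le_add fun ε hε => ?_
  -- the weighted tails tend to zero, uniformly over the finite set `D`
  have hev : ∀ p ∈ D, ∀ᶠ z : ℕ in atTop, Real.sqrt p *
      ∑' k : ℕ, (fun n : ℕ => if p ∣ n then c n / n else (0 : ℝ)) (k + (z + 1)) < ε / (D.card + 1) := by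
    intro p hp
    have h1 : Tendsto (fun z : ℕ => Real.sqrt p *
        ∑' k : ℕ, (fun n : ℕ => if p ∣ n then c n / n else (0 : ℝ)) (k + (z + 1))) atTop (𝓝 (Real.sqrt p * 0)) :=
      ((tendsto_sum_nat_add (fun n : ℕ => if p ∣ n then c n / n else (0 : ℝ))).comp
        (tendsto_add_atTop_nat 1)).const_mul _
    rw [mul_zero] at h1
    exact h1.eventually (gt_mem_nhds (by positivity))
  have hev' : ∀ᶠ z : ℕ in atTop, ∀ p ∈ D, Real.sqrt p *
      ∑' k : ℕ, (fun n : ℕ => if p ∣ n then c n / n else (0 : ℝ)) (k + (z + 1)) < ε / (D.card + 1) :=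
    (Filter.eventually_all_finset D).2 hev
  obtain ⟨z, hz1, hz2⟩ := (hev'.and (Filter.eventually_ge_atTop (D.sup id))).exists
  -- Step 2 at the level `Q = primes ≤ z`
  have hDQ : D ⊆ Nat.primesLE z := fun p hp =>
    Nat.mem_primesLE.2 ⟨le_trans (Finset.le_sup (f := id) hp) hz2, hD p hp⟩
  have hQ : ∀ q ∈ Nat.primesLE z, q.Prime := fun q hq => Nat.prime_of_mem_primesLE hq
  have hstep := deficit_finset_le_level c hc0 hLoc hTI C₁ hC₁ hC₁le (Nat.primesLE z) D hQ hDQ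
  -- bound the pollution by the tails
  have hpoll : ∑ p ∈ D, Real.sqrt p *
      ∑' n : ℕ, (if p ∣ n ∧ ¬ p ^ 2 ∣ n ∧ n ≠ p ∧ (∀ q ∈ Nat.primesLE z, q ∣ n → q = p) then c n / n else 0) ≤ ε := by
    calc ∑ p ∈ D, Real.sqrt p *
        ∑' n : ℕ, (if p ∣ n ∧ ¬ p ^ 2 ∣ n ∧ n ≠ p ∧ (∀ q ∈ Nat.primesLE z, q ∣ n → q = p) then c n / n else 0)
        ≤ ∑ p ∈ D, ε / (D.card + 1) := by
          refine Finset.sum_le_sum fun p hp => le_trans ?_ (hz1 p hp).le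
          exact mul_le_mul_of_nonneg_left (pollution_le_tail c hc0 hLoc p (hD p hp) z) (Real.sqrt_nonneg _)
      _ = D.card * (ε / (D.card + 1)) := by rw [Finset.sum_const, nsmul_eq_mul]
      _ ≤ ε := by
          rw [mul_div_assoc']
          rw [div_le_iff₀ (by positivity)]
          nlinarith
  linarith

/-- **The prime deficit at the scale `1/2` converges** (seat-0; the output of the 2001 spine, here direct):
under Loc and TI, `Σ_p (log p − c(p))₊/√p < ∞`. [folklore] -/
theorem summable_deficit_sqrt (c : ℕ → ℝ) (hc0 : ∀ n, 0 ≤ c n)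
    (hLoc : ∀ p : ℕ, p.Prime → Summable (fun n : ℕ => if p ∣ n then c n / n else 0))
    (hTI : ∀ α : ℕ → ℂ, ∀ L : ℕ, (∀ m, L < m → α m = 0) →
      ∃ T : ℝ, Tendsto (fun x : ℝ => ∑ n ∈ Finset.Icc 1 ⌊x⌋₊,
          (c n - ArithmeticFunction.vonMangoldt n) / n *
            (∑ ℓ ∈ Finset.Icc 1 L, ∑ ℓ' ∈ Finset.Icc 1 L, α ℓ * (starRingEnd ℂ) (α ℓ') *
            (((Nat.gcd (n * ℓ') ℓ : ℕ) : ℝ) : ℂ) / (Real.sqrt ((ℓ : ℝ) * ℓ') : ℂ)).re) atTop (𝓝 T) ∧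
        T ≤ 1 / 2 * (∑ ℓ ∈ Finset.Icc 1 L, ∑ ℓ' ∈ Finset.Icc 1 L, α ℓ * (starRingEnd ℂ) (α ℓ') *
            (((Nat.gcd (1 * ℓ') ℓ : ℕ) : ℝ) : ℂ) / (Real.sqrt ((ℓ : ℝ) * ℓ') : ℂ)).re) :
    Summable (fun p : ℕ => if p.Prime then max (Real.log p - c p) 0 / Real.sqrt p else 0) := by
  classical
  obtain ⟨C₁, hC₁, hC₁le⟩ := exists_C1 c hTI
  have h0 : ∀ p : ℕ, 0 ≤ (if p.Prime then max (Real.log p - c p) 0 / Real.sqrt p else 0) := fun p => by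
    split_ifs <;> positivity
  refine summable_of_sum_range_le h0 (c := 12 - 24 * C₁) fun N => ?_
  set D : Finset ℕ := (Finset.range N).filter (fun p => p.Prime ∧ c p < Real.log p) with hDdef
  have hD : ∀ p ∈ D, p.Prime := fun p hp => (Finset.mem_filter.1 hp).2.1
  have hle := deficit_finset_le c hc0 hLoc hTI C₁ hC₁ hC₁le D hD
  have heq : ∑ p ∈ Finset.range N, (if p.Prime then max (Real.log p - c p) 0 / Real.sqrt p else 0) =
      ∑ p ∈ D, (Real.log p - c p) / Real.sqrt p := by
    rw [hDdef, Finset.sum_filter]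
    refine Finset.sum_congr rfl fun p _ => ?_
    by_cases hp : p.Prime
    · rw [if_pos hp]
      by_cases hlt : c p < Real.log p
      · rw [if_pos ⟨hp, hlt⟩, max_eq_left (by linarith)]
      · rw [if_neg (fun h => hlt h.2), max_eq_right (by linarith), zero_div]
    · rw [if_neg hp, if_neg (fun h => hp h.1)]
  rw [heq]
  exact hle

/-! ### AX-A -/

/-- The negative part of `c − Λ` is summable against `1/n`: it lives on prime powers, where it is bounded by the
prime deficit at the scale `1/2` (primes) and by `Λ(n)/n` (higher prime powers). [folklore] -/
theorem summable_negPart_dwt_div (c : ℕ → ℝ) (hc0 : ∀ n, 0 ≤ c n)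
    (hdef : Summable (fun p : ℕ => if p.Prime then max (Real.log p - c p) 0 / Real.sqrt p else 0)) :
    Summable (fun n : ℕ => max (ArithmeticFunction.vonMangoldt n - c n) 0 / n) := by
  have hB := summable_vonMangoldt_nonprime_rpow (σ := 1) (by norm_num)
  refine Summable.of_nonneg_of_le (fun n => by positivity) (fun n => ?_) (hdef.add hB)
  have hrpow : (n : ℝ) ^ (-(1 : ℝ)) = 1 / n := by
    rw [Real.rpow_neg (Nat.cast_nonneg _), Real.rpow_one, one_div]
  by_cases hp : n.Prime
  · rw [if_pos hp, if_pos hp, zero_mul, add_zero, ArithmeticFunction.vonMangoldt_apply_prime hp]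
    have hn1 : (1 : ℝ) ≤ n := by exact_mod_cast hp.one_lt.le
    have hsq : Real.sqrt n ≤ n := by
      rw [Real.sqrt_le_left (by linarith)]
      nlinarith
    have hs0 : 0 < Real.sqrt n := Real.sqrt_pos.2 (by linarith)
    exact div_le_div_of_nonneg_left (by positivity) hs0 hsq
  · rw [if_neg hp, if_neg hp, zero_add, hrpow, mul_one_div]
    refine div_le_div_of_nonneg_right (max_le ?_ ArithmeticFunction.vonMangoldt_nonneg) (Nat.cast_nonneg _)
    linarith [hc0 n]

/-- **AX-A** (seat-0, design algebra §4): under Loc and TI, `Σ_n |c(n) − Λ(n)|/n < ∞`. [folklore] -/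
theorem summable_abs_dwt_div (c : ℕ → ℝ) (hc0 : ∀ n, 0 ≤ c n)
    (hLoc : ∀ p : ℕ, p.Prime → Summable (fun n : ℕ => if p ∣ n then c n / n else 0))
    (hTI : ∀ α : ℕ → ℂ, ∀ L : ℕ, (∀ m, L < m → α m = 0) →
      ∃ T : ℝ, Tendsto (fun x : ℝ => ∑ n ∈ Finset.Icc 1 ⌊x⌋₊,
          (c n - ArithmeticFunction.vonMangoldt n) / n *
            (∑ ℓ ∈ Finset.Icc 1 L, ∑ ℓ' ∈ Finset.Icc 1 L, α ℓ * (starRingEnd ℂ) (α ℓ') *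
            (((Nat.gcd (n * ℓ') ℓ : ℕ) : ℝ) : ℂ) / (Real.sqrt ((ℓ : ℝ) * ℓ') : ℂ)).re) atTop (𝓝 T) ∧
        T ≤ 1 / 2 * (∑ ℓ ∈ Finset.Icc 1 L, ∑ ℓ' ∈ Finset.Icc 1 L, α ℓ * (starRingEnd ℂ) (α ℓ') *
            (((Nat.gcd (1 * ℓ') ℓ : ℕ) : ℝ) : ℂ) / (Real.sqrt ((ℓ : ℝ) * ℓ') : ℂ)).re) :
    Summable (fun n : ℕ => |c n - ArithmeticFunction.vonMangoldt n| / n) := by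
  obtain ⟨C₁, hC₁, -⟩ := exists_C1 c hTI
  have hneg := summable_negPart_dwt_div c hc0 (summable_deficit_sqrt c hc0 hLoc hTI)
  -- the partial sums of `(c − Λ)/n` over `range N` converge, hence are bounded above
  set u : ℕ → ℝ := fun N => ∑ n ∈ Finset.range N, (c n - ArithmeticFunction.vonMangoldt n) / n with hu
  have hu1 : Tendsto (fun N : ℕ => u (N + 1)) atTop (𝓝 C₁) := by
    have h := hC₁.comp tendsto_natCast_atTop_atTop
    refine h.congr fun N => ?_
    simp only [Function.comp_apply, Nat.floor_natCast, hu]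
    rw [sum_Icc_eq_sum_range _ (by simp)]
  have hu2 : Tendsto u atTop (𝓝 C₁) := (tendsto_add_atTop_iff_nat 1).1 hu1
  obtain ⟨M, hM⟩ := hu2.bddAbove_range
  -- the positive part has bounded partial sums
  have hpos : Summable (fun n : ℕ => max (c n - ArithmeticFunction.vonMangoldt n) 0 / n) := by
    refine summable_of_sum_range_le (fun n => by positivity)
      (c := M + ∑' n : ℕ, max (ArithmeticFunction.vonMangoldt n - c n) 0 / n) fun N => ?_
    have h1 : ∑ n ∈ Finset.range N, max (c n - ArithmeticFunction.vonMangoldt n) 0 / (n : ℝ) =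
        u N + ∑ n ∈ Finset.range N, max (ArithmeticFunction.vonMangoldt n - c n) 0 / (n : ℝ) := by
      rw [hu, ← Finset.sum_add_distrib]
      refine Finset.sum_congr rfl fun n _ => ?_
      rw [← add_div]
      congr 1
      rcases le_total (c n) (ArithmeticFunction.vonMangoldt n) with h | h
      · rw [max_eq_right (by linarith), max_eq_left (by linarith)]; ring
      · rw [max_eq_left (by linarith), max_eq_right (by linarith)]; ring
    rw [h1]
    exact add_le_add (hM ⟨N, rfl⟩) (hneg.sum_le_tsum (Finset.range N) (fun n _ => by positivity))
  refine (hpos.add hneg).congr fun n => ?_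
  rw [← add_div]
  congr 1
  rcases le_total (c n) (ArithmeticFunction.vonMangoldt n) with h | h
  · rw [max_eq_right (by linarith), max_eq_left (by linarith), abs_of_nonpos (by linarith)]; ring
  · rw [max_eq_left (by linarith), max_eq_right (by linarith), abs_of_nonneg (by linarith)]; ring

/-- **Registered sub-goal `designDeficitBound`** (seat-0 anchor of this file, design algebra §3–4 of the proof of
`stub_designOfTypes`): under Loc and TI the prime deficit at the scale `1/2` converges and AX-A holds. [folklore] -/
theorem designDeficitBound : ∀ c : ℕ → ℝ, (∀ n, 0 ≤ c n) →
    (∀ p : ℕ, p.Prime → Summable (fun n : ℕ => if p ∣ n then c n / n else 0)) →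
    (∀ α : ℕ → ℂ, ∀ L : ℕ, (∀ m, L < m → α m = 0) →
      ∃ T : ℝ, Filter.Tendsto (fun x : ℝ => ∑ n ∈ Finset.Icc 1 ⌊x⌋₊,
          (c n - ArithmeticFunction.vonMangoldt n) / n *
            (∑ ℓ ∈ Finset.Icc 1 L, ∑ ℓ' ∈ Finset.Icc 1 L, α ℓ * (starRingEnd ℂ) (α ℓ') *
            (((Nat.gcd (n * ℓ') ℓ : ℕ) : ℝ) : ℂ) / (Real.sqrt ((ℓ : ℝ) * ℓ') : ℂ)).re) Filter.atTop (nhds T) ∧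
        T ≤ 1 / 2 * (∑ ℓ ∈ Finset.Icc 1 L, ∑ ℓ' ∈ Finset.Icc 1 L, α ℓ * (starRingEnd ℂ) (α ℓ') *
            (((Nat.gcd (1 * ℓ') ℓ : ℕ) : ℝ) : ℂ) / (Real.sqrt ((ℓ : ℝ) * ℓ') : ℂ)).re) →
    Summable (fun p : ℕ => if p.Prime then max (Real.log p - c p) 0 / Real.sqrt p else 0) ∧
    Summable (fun n : ℕ => |c n - ArithmeticFunction.vonMangoldt n| / n) :=
  fun c hc0 hLoc hTI => ⟨summable_deficit_sqrt c hc0 hLoc hTI, summable_abs_dwt_div c hc0 hLoc hTI⟩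

end Design

end Summit.RiemannHypothesis.RiemannHypothesis.Theorems.SignConeConeMagnification
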